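import Summits.ValiantsHypothesis.ValiantsHypothesis.Theorems.SoloBlindShadowCeiling
import Summits.ValiantsHypothesis.ValiantsHypothesis.Theorems.KPlusLogSqLawTropicalBTowerLogOfShadowBound

/-!
# Route «KPlusLogSqLaw», crux `TropicalB` (stmt-ValiantsHypothesis-19771) — the attack foothold `stub_tropTowerLog` FOLLOWS FROM the
# weak Newton-polygon τ-conjecture; refuting the foothold refutes `newtonTauWeak`

HONEST FRAMING.  Def-free helper toward the registered stubs of the crux `TropicalB` (`--supports stmt-ValiantsHypothesis-19771`):
the five-line instantiation `L := intProj a b` (`…Theorems.intProj_permMatrix`) of the ceiling-shape hypothesis of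
`…TropicalBTowerLogOfShadowBound` by the tree's conjecture `…Theorems.SeparatingShadowCeiling`, and through
`…Theorems.separatingShadowCeiling_of_newtonTauWeak` (Hrubeš–Yehudayoff 2021 footnote 1 / Forbes, kernel form in
`…SoloBlindShadowCeiling`) by `Literature…KPTT.newtonTauWeak`.  Every statement is an implication FROM an open conjecture;
nothing asserts `TropicalB`, `KPlusLogSqLaw`, `MatrixDescartes`, the conjectures themselves, or anything on VP ≠ VNP.

* `rowBound_of_separatingShadowCeiling` / `rowBound_of_newtonTauWeak`: `T(m, K) ≤ (m²(K−1)+1)(m+2)^{c(⌊√m⌋+1)} − 1` for ALL `m, K`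
  (`log₂ T = O(√m·log m + log K)`);
* `towerLog_of_newtonTauWeak`: `KPTT.newtonTauWeak → ∃ C, ∀ K, TropRootLawAt (K·⌊log₂K⌋) K (2^{C·K})` — the registered ATTACK FOOTHOLD
  `stub_tropTowerLog` of `Cruxes/TropicalB/Lines/birth.lean` (its `TropRow` is δ-equal to `TropRootLawAt`) holds CONDITIONALLY on the
  weak Newton-polygon τ-conjecture; `fatStrip_of_newtonTauWeak`: so does `TropicalB` on the strip `⌊√m⌋(⌊log₂ m⌋+1) ≤ K`, i.e. under
  `newtonTauWeak` the registered `stub_tropFat` shrinks to `⌊log₂ m⌋² ≤ K < ⌊√m⌋(⌊log₂ m⌋+1)`;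
* `not_newtonTauWeak_of_not_towerLog` — KILL SWITCH: a refutation of the foothold (for every `C` some `K`-slope dominance design on
  `K⌊log₂K⌋` nodes with more than `2^{CK}` sign-alternating unique optima) refutes `SeparatingShadowCeiling` and hence `newtonTauWeak`,
  the Newton-polygon line's sufficient condition for VP ≠ VNP (route NewtonUnitEquations).  (Evidence #47 on the item used K-fold
  static PORTS, `n = K²log K` nodes, landing below the ceiling; the same-size static reduction keeps `n = K log K`.)
[folklore] glue; the located remark is Hrubeš–Yehudayoff 2021 (doi:10.4230/LIPIcs.CCC.2021.9) p. 9:2 footnote 1.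
-/

set_option linter.dupNamespace false
set_option autoImplicit false

namespace Summit.ValiantsHypothesis.ValiantsHypothesis.Theorems.KPlusLogSqLaw.ShadowCeilingBridge

open Summit.ValiantsHypothesis.ValiantsHypothesis.Theorems.MatrixDescartes.Negative
open Summit.ValiantsHypothesis.ValiantsHypothesis.Theorems.LacunarySymmetroidMatrixDescartes.TropicalCensus
open Summit.ValiantsHypothesis.ValiantsHypothesis.Theorems
open Literature.Computability.AlgebraicComplexity
open Finset

/-- `intProj a b` realises the pair `(a, b)` on permutation matrices. [folklore] -/
theorem intProj_realises {m : ℕ} (a b : Fin m × Fin m → ℕ) (ρ : Equiv.Perm (Fin m)) :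
    intProj a b (fun ij : Fin m × Fin m => if ρ ij.2 = ij.1 then (1 : ℝ) else 0) =
      fun i : Fin 2 => if i = 0 then ((∑ j, a (ρ j, j) : ℕ) : ℝ) else ((∑ j, b (ρ j, j) : ℕ) : ℝ) := by
  rw [intProj_permMatrix]
  funext i
  fin_cases i
  · simp [permExp_apply_zero]
  · simp [permExp_apply_one]

/-- `SeparatingShadowCeiling` is a ceiling of the shape consumed by `…TowerLogOfShadowBound`. [folklore] -/
theorem ceilingShape_of_separatingShadowCeiling (h : SeparatingShadowCeiling) :
    ∃ c : ℕ, ∀ (m : ℕ) (a b : Fin m × Fin m → ℕ),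
      Function.Injective (fun ρ : Equiv.Perm (Fin m) => (∑ j, a (ρ j, j), ∑ j, b (ρ j, j))) →
      ∃ L : (Fin m × Fin m → ℝ) →ₗ[ℝ] (Fin 2 → ℝ),
        (∀ ρ : Equiv.Perm (Fin m), L (fun ij => if ρ ij.2 = ij.1 then 1 else 0) =
          fun i : Fin 2 => if i = 0 then ((∑ j, a (ρ j, j) : ℕ) : ℝ) else ((∑ j, b (ρ j, j) : ℕ) : ℝ)) ∧
        birkhoffShadowVertexCount L ≤ (m + 2) ^ (c * (Nat.sqrt m + 1)) := by
  obtain ⟨c, hc⟩ := h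
  exact ⟨c, fun m a b hab => ⟨intProj a b, intProj_realises a b, hc m a b hab⟩⟩

/-- **Tropical rows under the separating-shadow ceiling**: `T(m,K) ≤ (m²(K−1)+1)(m+2)^{c(⌊√m⌋+1)} − 1` for all `m, K`. [folklore] -/
theorem rowBound_of_separatingShadowCeiling (h : SeparatingShadowCeiling) :
    ∃ c : ℕ, ∀ m K : ℕ, TropRootLawAt m K ((m * m * (K - 1) + 1) * (m + 2) ^ (c * (Nat.sqrt m + 1)) - 1) := by
  obtain ⟨c, hc⟩ := ceilingShape_of_separatingShadowCeiling h
  exact ⟨c, rowBound_of_ceilingShape c hc⟩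

/-- **The foothold under the ceiling**: `SeparatingShadowCeiling → ∃ C, ∀ K, T(K⌊log₂K⌋, K) ≤ 2^{C·K}`. [folklore] -/
theorem towerLog_of_separatingShadowCeiling (h : SeparatingShadowCeiling) :
    ∃ C : ℕ, ∀ K : ℕ, TropRootLawAt (K * Nat.log 2 K) K (2 ^ (C * K)) := by
  obtain ⟨c, hc⟩ := ceilingShape_of_separatingShadowCeiling h
  exact (towerLog_and_fatStrip_of_ceilingShape c hc).1

/-- **The fat strip under the ceiling**: `SeparatingShadowCeiling → ∃ C, ∀ m K, ⌊√m⌋(⌊log₂ m⌋+1) ≤ K → T(m,K) ≤ 2^{C·K}`. [folklore] -/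
theorem fatStrip_of_separatingShadowCeiling (h : SeparatingShadowCeiling) :
    ∃ C : ℕ, ∀ m K : ℕ, Nat.sqrt m * (Nat.log 2 m + 1) ≤ K → TropRootLawAt m K (2 ^ (C * K)) := by
  obtain ⟨c, hc⟩ := ceilingShape_of_separatingShadowCeiling h
  exact (towerLog_and_fatStrip_of_ceilingShape c hc).2

/-- **Tropical rows under the weak Newton-polygon τ-conjecture.** [folklore] -/
theorem rowBound_of_newtonTauWeak (h : KPTT.newtonTauWeak) :
    ∃ c : ℕ, ∀ m K : ℕ, TropRootLawAt m K ((m * m * (K - 1) + 1) * (m + 2) ^ (c * (Nat.sqrt m + 1)) - 1) :=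
  rowBound_of_separatingShadowCeiling (separatingShadowCeiling_of_newtonTauWeak h)

/-- **THE ATTACK FOOTHOLD `stub_tropTowerLog` UNDER `newtonTauWeak`** (conditional discharge; `TropRow` of the registered
skeleton is δ-equal to `TropRootLawAt`). [folklore] -/
theorem towerLog_of_newtonTauWeak (h : KPTT.newtonTauWeak) :
    ∃ C : ℕ, ∀ K : ℕ, TropRootLawAt (K * Nat.log 2 K) K (2 ^ (C * K)) :=
  towerLog_of_separatingShadowCeiling (separatingShadowCeiling_of_newtonTauWeak h)

/-- **The fat strip of `TropicalB` under `newtonTauWeak`.** [folklore] -/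
theorem fatStrip_of_newtonTauWeak (h : KPTT.newtonTauWeak) :
    ∃ C : ℕ, ∀ m K : ℕ, Nat.sqrt m * (Nat.log 2 m + 1) ≤ K → TropRootLawAt m K (2 ^ (C * K)) :=
  fatStrip_of_separatingShadowCeiling (separatingShadowCeiling_of_newtonTauWeak h)

/-- **KILL SWITCH, ceiling form**: refuting the foothold refutes `SeparatingShadowCeiling`. [folklore] -/
theorem not_separatingShadowCeiling_of_not_towerLog
    (h : ¬ ∃ C : ℕ, ∀ K : ℕ, TropRootLawAt (K * Nat.log 2 K) K (2 ^ (C * K))) : ¬ SeparatingShadowCeiling :=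
  fun hc => h (towerLog_of_separatingShadowCeiling hc)

/-- **KILL SWITCH**: refuting the foothold refutes the weak Newton-polygon τ-conjecture `KPTT.newtonTauWeak`. [folklore] -/
theorem not_newtonTauWeak_of_not_towerLog
    (h : ¬ ∃ C : ℕ, ∀ K : ℕ, TropRootLawAt (K * Nat.log 2 K) K (2 ^ (C * K))) : ¬ KPTT.newtonTauWeak :=
  fun hW => h (towerLog_of_newtonTauWeak hW)

end Summit.ValiantsHypothesis.ValiantsHypothesis.Theorems.KPlusLogSqLaw.ShadowCeilingBridge
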